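import Mathlib.Analysis.Polynomial.Basic
import Mathlib.RingTheory.Polynomial.Pochhammer
import Mathlib.Algebra.Order.BigOperators.Ring.Finset
import Mathlib.Topology.Order.Compact
import HarnessLib

/-!
# Crux `WeilTwelvefoldsSqrtMinus7` (stmt-HodgeConjecture-1261), line `polya-glued-box-products` ·
# stub 1 `stub_polyaMultiplier`: the Poincaré–Pólya positive multiplier theorem

Route `HeckePrymWeil` (sub-problem `HodgeConjecture`); lead seat c9 of crux `WeilTwelvefoldsSqrtMinus7`,
line `polya-glued-box-products` (skeleton r1 of lead c7).  This file proves the registered stub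
`stub_polyaMultiplier` VERBATIM, unconditionally: for every real polynomial `q` with `q(x) > 0` for
all `x ≥ 0` there is an `N` such that every coefficient of `(1 + X)^N · q` is non-negative
(H. Poincaré, C. R. Acad. Sci. Paris 97 (1883); G. Pólya, Vierteljschr. Naturforsch. Ges. Zürich 73
(1928); Hardy–Littlewood–Pólya, *Inequalities*, §2.24) — the arithmetic engine of the line's move (Π).

Proof (Pólya's, quantitative).  `d = deg q`, `q = Σⱼ aⱼ Xʲ`, `h(u) = Σⱼ aⱼ uʲ (1-u)^{d-j}`:
`h(u) = (1-u)^d q(u/(1-u)) > 0` for `u < 1`, `h(1) = a_d > 0`, so `h ≥ μ > 0` on `[0,1]` (§2).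
For `n = N + d`, `k ≤ n`, `b = n - k`: `coeff_k((1+X)^N q) · k! b! = N! Σⱼ aⱼ k^{(j)} b^{(d-j)}`
(falling factorials, §3) and `k^{(j)} b^{(d-j)} = n^d Πₘ₍<ⱼ₎(u - m/n) Πₘ₍<d-j₎(1 - u - m/n)`,
`u = k/n` (§4); the perturbation bound `|Π xₘ - Π yₘ| ≤ Σ |xₘ - yₘ|` on `[-1,1]` (§1) gives
`|Σⱼ aⱼ Π Π - h(u)| ≤ (Σⱼ|aⱼ|) d²/n < μ` once `N > (Σⱼ|aⱼ|) d²/μ` (§5).  Mathlib only; no `sorry`,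
no definition, no hypothesis beyond the registered signature.
-/

noncomputable section

-- every declaration of this problem lives in `Summit.HodgeConjecture.HodgeConjecture.…` (summit = sub-problem)
set_option linter.dupNamespace false

namespace Summit.HodgeConjecture.HodgeConjecture.Theorems.WeilTwelvefoldsSqrtMinus7.PolyaGluedBoxProducts

open Polynomial Finset

/-! ### §1 An elementary perturbation bound for products of numbers in `[-1, 1]` -/

/-- `|Πₘ₍<n₎ xₘ - Πₘ₍<n₎ yₘ| ≤ Σₘ₍<n₎ |xₘ - yₘ|` when all `|xₘ|, |yₘ| ≤ 1` (telescoping).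
[folklore] -/
theorem polya_abs_prod_sub_prod_le (n : ℕ) (x y : ℕ → ℝ) (hx : ∀ m < n, |x m| ≤ 1)
    (hy : ∀ m < n, |y m| ≤ 1) :
    |∏ m ∈ range n, x m - ∏ m ∈ range n, y m| ≤ ∑ m ∈ range n, |x m - y m| := by
  induction n with
  | zero => simp
  | succ n ih =>
    have hx' : ∀ m < n, |x m| ≤ 1 := fun m hm => hx m (Nat.lt_succ_of_lt hm)
    have hy' : ∀ m < n, |y m| ≤ 1 := fun m hm => hy m (Nat.lt_succ_of_lt hm)
    have hP : |∏ m ∈ range n, x m| ≤ 1 := by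
      rw [Finset.abs_prod]
      exact Finset.prod_le_one (fun m _ => abs_nonneg _) fun m hm => hx' m (mem_range.mp hm)
    have hQ : |y n| ≤ 1 := hy n (Nat.lt_succ_self n)
    rw [prod_range_succ, prod_range_succ, sum_range_succ]
    have key : (∏ m ∈ range n, x m) * x n - (∏ m ∈ range n, y m) * y n =
        (∏ m ∈ range n, x m) * (x n - y n) + ((∏ m ∈ range n, x m) - ∏ m ∈ range n, y m) * y n := by
      ring
    rw [key]
    calc |(∏ m ∈ range n, x m) * (x n - y n) + ((∏ m ∈ range n, x m) - ∏ m ∈ range n, y m) * y n|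
        ≤ |(∏ m ∈ range n, x m) * (x n - y n)| + |((∏ m ∈ range n, x m) - ∏ m ∈ range n, y m) * y n| :=
          abs_add_le _ _
      _ = |∏ m ∈ range n, x m| * |x n - y n| + |(∏ m ∈ range n, x m) - ∏ m ∈ range n, y m| * |y n| := by
          rw [abs_mul, abs_mul]
      _ ≤ 1 * |x n - y n| + |(∏ m ∈ range n, x m) - ∏ m ∈ range n, y m| * 1 := by
          gcongr
      _ ≤ (∑ m ∈ range n, |x m - y m|) + |x n - y n| := by
          rw [one_mul, mul_one, add_comm]
          gcongr
          exact ih hx' hy'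

/-- The perturbation bound for the Pólya factors: for `u ∈ [0,1]`, `j ≤ d ≤ n`, `0 < n`,
`|Πₘ₍<ⱼ₎ (u - m/n) - uʲ| ≤ j · (d/n)`. [folklore] -/
theorem polya_abs_prod_sub_pow_le (d n j : ℕ) (u : ℝ) (hu0 : 0 ≤ u) (hu1 : u ≤ 1) (hn : 0 < n)
    (hdn : d ≤ n) (hjd : j ≤ d) :
    |(∏ m ∈ range j, (u - (m : ℝ) / n)) - u ^ j| ≤ (j : ℝ) * ((d : ℝ) / n) := by
  have hdn' : (d : ℝ) / n ≤ 1 := (div_le_one (by exact_mod_cast hn)).mpr (by exact_mod_cast hdn)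
  have hmn : ∀ m < j, (0 : ℝ) ≤ (m : ℝ) / n ∧ (m : ℝ) / n ≤ (d : ℝ) / n := by
    intro m hm
    refine ⟨by positivity, ?_⟩
    gcongr
    exact_mod_cast (hm.le.trans hjd)
  have h := polya_abs_prod_sub_prod_le j (fun m => u - (m : ℝ) / n) (fun _ => u)
    (fun m hm => by
      obtain ⟨h0, h1⟩ := hmn m hm
      rw [abs_le]
      constructor <;> linarith)
    (fun m _ => by rw [abs_le]; constructor <;> linarith)
  rw [prod_const, card_range] at h
  refine h.trans ?_
  calc ∑ m ∈ range j, |u - (m : ℝ) / n - u| = ∑ m ∈ range j, (m : ℝ) / n := by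
        refine sum_congr rfl fun m hm => ?_
        rw [show u - (m : ℝ) / n - u = -((m : ℝ) / n) by ring, abs_neg,
          abs_of_nonneg (hmn m (mem_range.mp hm)).1]
    _ ≤ ∑ _m ∈ range j, (d : ℝ) / n := sum_le_sum fun m hm => (hmn m (mem_range.mp hm)).2
    _ = (j : ℝ) * ((d : ℝ) / n) := by rw [sum_const, card_range, nsmul_eq_mul]

/-- The two-sided Pólya term bound: for `u ∈ [0,1]`, `v = 1 - u`, `j ≤ d ≤ n`, `0 < n`,
`|Πₘ₍<ⱼ₎ (u - m/n) · Πₘ₍<d-j₎ (v - m/n) - uʲ v^{d-j}| ≤ d · (d/n)`. [folklore] -/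
theorem polya_term_approx (d n j : ℕ) (u : ℝ) (hu0 : 0 ≤ u) (hu1 : u ≤ 1) (hn : 0 < n)
    (hdn : d ≤ n) (hjd : j ≤ d) :
    |(∏ m ∈ range j, (u - (m : ℝ) / n)) * (∏ m ∈ range (d - j), ((1 - u) - (m : ℝ) / n)) -
        u ^ j * (1 - u) ^ (d - j)| ≤ (d : ℝ) * ((d : ℝ) / n) := by
  set P₁ := ∏ m ∈ range j, (u - (m : ℝ) / n) with hP₁
  set P₂ := ∏ m ∈ range (d - j), ((1 - u) - (m : ℝ) / n) with hP₂
  have hv0 : 0 ≤ 1 - u := by linarith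
  have hv1 : 1 - u ≤ 1 := by linarith
  have h₁ : |P₁ - u ^ j| ≤ (j : ℝ) * ((d : ℝ) / n) :=
    polya_abs_prod_sub_pow_le d n j u hu0 hu1 hn hdn hjd
  have h₂ : |P₂ - (1 - u) ^ (d - j)| ≤ ((d - j : ℕ) : ℝ) * ((d : ℝ) / n) :=
    polya_abs_prod_sub_pow_le d n (d - j) (1 - u) hv0 hv1 hn hdn (Nat.sub_le d j)
  have hdn' : (d : ℝ) / n ≤ 1 := (div_le_one (by exact_mod_cast hn)).mpr (by exact_mod_cast hdn)
  have hP₁le : |P₁| ≤ 1 := by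
    rw [hP₁, Finset.abs_prod]
    refine Finset.prod_le_one (fun m _ => abs_nonneg _) fun m hm => ?_
    have hm := mem_range.mp hm
    have h0 : (0 : ℝ) ≤ (m : ℝ) / n := by positivity
    have h1 : (m : ℝ) / n ≤ (d : ℝ) / n := by
      gcongr
      exact_mod_cast (hm.le.trans hjd)
    rw [abs_le]
    constructor <;> linarith
  have hQ₂le : |(1 - u) ^ (d - j)| ≤ 1 := by
    rw [abs_pow, abs_of_nonneg hv0]
    exact pow_le_one₀ hv0 hv1
  have key : P₁ * P₂ - u ^ j * (1 - u) ^ (d - j) =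
      P₁ * (P₂ - (1 - u) ^ (d - j)) + (P₁ - u ^ j) * (1 - u) ^ (d - j) := by ring
  rw [key]
  have hdj : (j : ℝ) + ((d - j : ℕ) : ℝ) = d := by
    rw [Nat.cast_sub hjd]
    ring
  calc |P₁ * (P₂ - (1 - u) ^ (d - j)) + (P₁ - u ^ j) * (1 - u) ^ (d - j)|
      ≤ |P₁ * (P₂ - (1 - u) ^ (d - j))| + |(P₁ - u ^ j) * (1 - u) ^ (d - j)| := abs_add_le _ _
    _ = |P₁| * |P₂ - (1 - u) ^ (d - j)| + |P₁ - u ^ j| * |(1 - u) ^ (d - j)| := by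
        rw [abs_mul, abs_mul]
    _ ≤ 1 * (((d - j : ℕ) : ℝ) * ((d : ℝ) / n)) + (j : ℝ) * ((d : ℝ) / n) * 1 := by
        gcongr
    _ = (d : ℝ) * ((d : ℝ) / n) := by rw [one_mul, mul_one, ← hdj]; ring


/-! ### §2 The homogenisation `h(u) = Σⱼ aⱼ uʲ (1-u)^{d-j}` on `[0, 1]` -/

/-- A real polynomial positive on `[0, ∞)` has positive leading coefficient. [folklore] -/
theorem polya_leadingCoeff_pos (q : ℝ[X]) (hq : ∀ x : ℝ, 0 ≤ x → 0 < q.eval x) :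
    0 < q.leadingCoeff := by
  by_contra h
  push Not at h
  by_cases hdeg : 0 < q.degree
  · have ht := q.tendsto_atBot_of_leadingCoeff_nonpos hdeg h
    rw [Filter.tendsto_atTop_atBot] at ht
    obtain ⟨i, hi⟩ := ht 0
    have h1 := hi (max i 0) (le_max_left _ _)
    have h2 := hq (max i 0) (le_max_right _ _)
    linarith
  · push Not at hdeg
    have hq0 := hq 0 le_rfl
    rw [eq_C_of_degree_le_zero hdeg] at hq0 h
    rw [eval_C] at hq0
    rw [leadingCoeff_C] at h
    linarith

/-- `h(u) = (1-u)^d · q(u/(1-u))` for `u ≠ 1` (`d = deg q`). [folklore] -/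
theorem polya_homog_eq (q : ℝ[X]) (u : ℝ) (hu : u ≠ 1) :
    ∑ j ∈ range (q.natDegree + 1), q.coeff j * u ^ j * (1 - u) ^ (q.natDegree - j) =
      (1 - u) ^ q.natDegree * q.eval (u / (1 - u)) := by
  have h1u : (1 - u) ≠ 0 := sub_ne_zero.mpr (Ne.symm hu)
  rw [eval_eq_sum_range, mul_sum]
  refine sum_congr rfl fun j hj => ?_
  have hjd : j ≤ q.natDegree := Nat.lt_succ_iff.mp (mem_range.mp hj)
  rw [div_pow, ← pow_sub_mul_pow (1 - u) hjd]
  field_simp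

/-- `h(1) = a_d`, the leading coefficient. [folklore] -/
theorem polya_homog_one (q : ℝ[X]) :
    ∑ j ∈ range (q.natDegree + 1), q.coeff j * (1 : ℝ) ^ j * (1 - 1) ^ (q.natDegree - j) =
      q.leadingCoeff := by
  rw [sum_eq_single q.natDegree]
  · simp only [one_pow, mul_one, Nat.sub_self, pow_zero, coeff_natDegree]
  · intro j hj hne
    have hlt : j < q.natDegree := lt_of_le_of_ne (Nat.lt_succ_iff.mp (mem_range.mp hj)) hne
    rw [sub_self, zero_pow (Nat.sub_ne_zero_of_lt hlt), mul_zero]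
  · intro h
    exact absurd (mem_range.mpr (Nat.lt_succ_self _)) h

/-- `h(u) > 0` on `[0, 1]` for `q` positive on `[0, ∞)`. [folklore] -/
theorem polya_homog_pos (q : ℝ[X]) (hq : ∀ x : ℝ, 0 ≤ x → 0 < q.eval x) (u : ℝ) (hu0 : 0 ≤ u)
    (hu1 : u ≤ 1) :
    0 < ∑ j ∈ range (q.natDegree + 1), q.coeff j * u ^ j * (1 - u) ^ (q.natDegree - j) := by
  rcases eq_or_lt_of_le hu1 with rfl | hlt
  · rw [polya_homog_one]
    exact polya_leadingCoeff_pos q hq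
  · rw [polya_homog_eq q u hlt.ne]
    have h1u : 0 < 1 - u := by linarith
    exact mul_pos (pow_pos h1u _) (hq _ (div_nonneg hu0 h1u.le))

/-- Compactness: `h ≥ μ > 0` on `[0, 1]`. [folklore] -/
theorem polya_exists_pos_lower_bound (q : ℝ[X]) (hq : ∀ x : ℝ, 0 ≤ x → 0 < q.eval x) :
    ∃ μ : ℝ, 0 < μ ∧ ∀ u : ℝ, 0 ≤ u → u ≤ 1 →
      μ ≤ ∑ j ∈ range (q.natDegree + 1), q.coeff j * u ^ j * (1 - u) ^ (q.natDegree - j) := by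
  have hcont : Continuous fun u : ℝ =>
      ∑ j ∈ range (q.natDegree + 1), q.coeff j * u ^ j * (1 - u) ^ (q.natDegree - j) :=
    continuous_finsetSum _ fun j _ => by fun_prop
  obtain ⟨u₀, hu₀, hmin⟩ := isCompact_Icc.exists_isMinOn (Set.nonempty_Icc.mpr zero_le_one)
    hcont.continuousOn
  refine ⟨_, polya_homog_pos q hq u₀ hu₀.1 hu₀.2, fun u h0 h1 => ?_⟩
  exact hmin (Set.mem_Icc.mpr ⟨h0, h1⟩)

/-! ### §3 The coefficients of `(1 + X)^N · q` and falling factorials -/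

/-- `coeff_k((1+X)^N q) = Σ_{j ≤ d} aⱼ · C(N, k - j)` (terms with `j > k` absent). [folklore] -/
theorem polya_coeff_eq (q : ℝ[X]) (N k : ℕ) :
    (((1 : ℝ[X]) + X) ^ N * q).coeff k =
      ∑ j ∈ range (q.natDegree + 1), q.coeff j * (if j ≤ k then (N.choose (k - j) : ℝ) else 0) := by
  conv_lhs => rw [q.as_sum_range_C_mul_X_pow, mul_sum, finsetSum_coeff]
  refine sum_congr rfl fun j _ => ?_
  rw [show ((1 : ℝ[X]) + X) ^ N * (C (q.coeff j) * X ^ j) = C (q.coeff j) * (X ^ j * ((1 : ℝ[X]) + X) ^ N)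
    by ring, coeff_C_mul, coeff_X_pow_mul']
  split_ifs with h
  · rw [coeff_one_add_X_pow]
  · rfl

/-- The binomial identity `C(N, k-j) · k! · b! = N! · k^{(j)} · b^{(d-j)}` for `j ≤ k ≤ N + d`,
`j ≤ d`, `b = N + d - k` (falling factorials; both sides vanish when `k - j > N`). [folklore] -/
theorem polya_choose_mul_factorial (N d k j : ℕ) (hj : j ≤ k) (hjd : j ≤ d) (hk : k ≤ N + d) :
    N.choose (k - j) * (k.factorial * (N + d - k).factorial) =
      N.factorial * (k.descFactorial j * (N + d - k).descFactorial (d - j)) := by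
  by_cases h : k - j ≤ N
  · have e1 : (k - j).factorial * k.descFactorial j = k.factorial := Nat.factorial_mul_descFactorial hj
    have hb : d - j ≤ N + d - k := by omega
    have e2 : (N + d - k - (d - j)).factorial * (N + d - k).descFactorial (d - j) =
        (N + d - k).factorial := Nat.factorial_mul_descFactorial hb
    have e3 : N.choose (k - j) * (k - j).factorial * (N - (k - j)).factorial = N.factorial :=
      Nat.choose_mul_factorial_mul_factorial h
    have e4 : N + d - k - (d - j) = N - (k - j) := by omega
    rw [e4] at e2
    calc N.choose (k - j) * (k.factorial * (N + d - k).factorial)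
        = N.choose (k - j) * (((k - j).factorial * k.descFactorial j) *
            ((N - (k - j)).factorial * (N + d - k).descFactorial (d - j))) := by rw [e1, e2]
      _ = (N.choose (k - j) * (k - j).factorial * (N - (k - j)).factorial) *
            (k.descFactorial j * (N + d - k).descFactorial (d - j)) := by ring
      _ = N.factorial * (k.descFactorial j * (N + d - k).descFactorial (d - j)) := by rw [e3]
  · push Not at h
    rw [Nat.choose_eq_zero_of_lt h, zero_mul]
    have h0 : (N + d - k).descFactorial (d - j) = 0 := Nat.descFactorial_eq_zero_iff_lt.mpr (by omega)
    rw [h0, mul_zero, mul_zero]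

/-- `coeff_k((1+X)^N q) · k! · b! = N! · Σⱼ aⱼ k^{(j)} b^{(d-j)}` for `k ≤ N + d`, `b = N + d - k`.
[folklore] -/
theorem polya_coeff_mul_factorial (q : ℝ[X]) (N k : ℕ) (hk : k ≤ N + q.natDegree) :
    (((1 : ℝ[X]) + X) ^ N * q).coeff k * ((k.factorial : ℝ) * ((N + q.natDegree - k).factorial : ℝ)) =
      (N.factorial : ℝ) * ∑ j ∈ range (q.natDegree + 1), q.coeff j * (k.descFactorial j : ℝ) *
        ((N + q.natDegree - k).descFactorial (q.natDegree - j) : ℝ) := by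
  rw [polya_coeff_eq, sum_mul, mul_sum]
  refine sum_congr rfl fun j hj => ?_
  have hjd : j ≤ q.natDegree := Nat.lt_succ_iff.mp (mem_range.mp hj)
  split_ifs with hjk
  · have h := polya_choose_mul_factorial N q.natDegree k j hjk hjd hk
    have h' : (N.choose (k - j) : ℝ) * ((k.factorial : ℝ) * ((N + q.natDegree - k).factorial : ℝ)) =
        (N.factorial : ℝ) * ((k.descFactorial j : ℝ) *
          ((N + q.natDegree - k).descFactorial (q.natDegree - j) : ℝ)) := by exact_mod_cast h
    calc q.coeff j * (N.choose (k - j) : ℝ) * ((k.factorial : ℝ) * ((N + q.natDegree - k).factorial : ℝ))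
        = q.coeff j * ((N.choose (k - j) : ℝ) * ((k.factorial : ℝ) *
            ((N + q.natDegree - k).factorial : ℝ))) := by ring
      _ = q.coeff j * ((N.factorial : ℝ) * ((k.descFactorial j : ℝ) *
            ((N + q.natDegree - k).descFactorial (q.natDegree - j) : ℝ))) := by rw [h']
      _ = (N.factorial : ℝ) * (q.coeff j * (k.descFactorial j : ℝ) *
            ((N + q.natDegree - k).descFactorial (q.natDegree - j) : ℝ)) := by ring
  · push Not at hjk
    have h0 : k.descFactorial j = 0 := Nat.descFactorial_eq_zero_iff_lt.mpr hjk
    rw [h0]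
    simp

/-! ### §4 Normalisation: `k^{(j)} = n^j · Πₘ₍<ⱼ₎ (k/n - m/n)` -/

/-- `k^{(j)} = Πₘ₍<ⱼ₎ (k - m)` over `ℝ`. [folklore] -/
theorem polya_descFactorial_eq_prod (k j : ℕ) :
    (k.descFactorial j : ℝ) = ∏ m ∈ range j, ((k : ℝ) - m) := by
  rw [← descPochhammer_eval_eq_descFactorial ℝ k j, descPochhammer_eval_eq_prod_range]

/-- `k^{(j)} = n^j · Πₘ₍<ⱼ₎ (k/n - m/n)` for `0 < n`. [folklore] -/
theorem polya_descFactorial_eq_pow_mul_prod (n k j : ℕ) (hn : 0 < n) :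
    (k.descFactorial j : ℝ) = (n : ℝ) ^ j * ∏ m ∈ range j, ((k : ℝ) / n - (m : ℝ) / n) := by
  have hn' : (n : ℝ) ≠ 0 := by exact_mod_cast hn.ne'
  rw [polya_descFactorial_eq_prod]
  have : ∀ m ∈ range j, ((k : ℝ) - m) = (n : ℝ) * ((k : ℝ) / n - (m : ℝ) / n) := by
    intro m _
    field_simp
  rw [prod_congr rfl this, prod_mul_distrib, prod_const, card_range]

/-- The approximation `|Σⱼ aⱼ Π(u - m/n) Π((1-u) - m/n) - h(u)| ≤ (Σⱼ |aⱼ|) · d · (d/n)` for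
`u ∈ [0,1]`, `d ≤ n`, `0 < n`. [folklore] -/
theorem polya_sum_approx (q : ℝ[X]) (n : ℕ) (u : ℝ) (hu0 : 0 ≤ u) (hu1 : u ≤ 1) (hn : 0 < n)
    (hdn : q.natDegree ≤ n) :
    |(∑ j ∈ range (q.natDegree + 1), q.coeff j * (∏ m ∈ range j, (u - (m : ℝ) / n)) *
        (∏ m ∈ range (q.natDegree - j), ((1 - u) - (m : ℝ) / n))) -
      ∑ j ∈ range (q.natDegree + 1), q.coeff j * u ^ j * (1 - u) ^ (q.natDegree - j)|
      ≤ (∑ j ∈ range (q.natDegree + 1), |q.coeff j|) *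
        ((q.natDegree : ℝ) * ((q.natDegree : ℝ) / n)) := by
  rw [← sum_sub_distrib, sum_mul]
  refine (abs_sum_le_sum_abs _ _).trans (sum_le_sum fun j hj => ?_)
  have hjd : j ≤ q.natDegree := Nat.lt_succ_iff.mp (mem_range.mp hj)
  rw [show q.coeff j * (∏ m ∈ range j, (u - (m : ℝ) / n)) *
        (∏ m ∈ range (q.natDegree - j), ((1 - u) - (m : ℝ) / n)) -
        q.coeff j * u ^ j * (1 - u) ^ (q.natDegree - j) =
      q.coeff j * ((∏ m ∈ range j, (u - (m : ℝ) / n)) *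
        (∏ m ∈ range (q.natDegree - j), ((1 - u) - (m : ℝ) / n)) - u ^ j * (1 - u) ^ (q.natDegree - j))
      by ring, abs_mul]
  exact mul_le_mul_of_nonneg_left (polya_term_approx q.natDegree n j u hu0 hu1 hn hdn hjd)
    (abs_nonneg _)

/-! ### §5 The theorem -/

/-- **Stub 1 `stub_polyaMultiplier` — the Poincaré–Pólya positive multiplier theorem** (registered
signature, UNCONDITIONAL): a real polynomial `q` with `q(x) > 0` for every `x ≥ 0` becomes
coefficientwise non-negative after multiplication by a suitable power of `1 + X`.  (In fact the
proof gives strictly positive coefficients in all degrees `≤ N + deg q`.)  Poincaré 1883; Pólya 1928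
(homogeneous form: a form positive on the closed simplex times a high power of `x + y` has positive
coefficients); Hardy–Littlewood–Pólya, *Inequalities*, Thm. 56 / §2.24.  Proof: module docstring.
[folklore] -/
theorem stub_polyaMultiplier :
    ∀ q : Polynomial ℝ, (∀ x : ℝ, 0 ≤ x → 0 < q.eval x) →
      ∃ N : ℕ, ∀ i : ℕ, 0 ≤ (((1 : Polynomial ℝ) + Polynomial.X) ^ N * q).coeff i := by
  intro q hq
  set d := q.natDegree with hd
  obtain ⟨μ, hμ, hμle⟩ := polya_exists_pos_lower_bound q hq
  set A := ∑ j ∈ range (q.natDegree + 1), |q.coeff j| with hA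
  have hA0 : 0 ≤ A := sum_nonneg fun j _ => abs_nonneg _
  obtain ⟨N, hN⟩ := exists_nat_gt (A * ((d : ℝ) * d) / μ)
  have hN0 : 0 < N := by
    have : (0 : ℝ) ≤ A * ((d : ℝ) * d) / μ := by positivity
    exact_mod_cast this.trans_lt hN
  refine ⟨N, fun k => ?_⟩
  by_cases hk : k ≤ N + d
  · -- degrees `k ≤ N + d`: the coefficient is positive
    set n := N + d with hn
    have hn0 : 0 < n := by omega
    have hn0' : (0 : ℝ) < n := by exact_mod_cast hn0
    have hdn : d ≤ n := by omega
    have hkn : k ≤ n := hk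
    set b := n - k with hb
    set u : ℝ := (k : ℝ) / n with hu
    have hu0 : 0 ≤ u := by positivity
    have hu1 : u ≤ 1 := by
      rw [hu, div_le_one hn0']
      exact_mod_cast hkn
    have hbu : (b : ℝ) / n = 1 - u := by
      rw [hb, Nat.cast_sub hkn, sub_div, div_self hn0'.ne']
    -- the normalised sum `S`
    set S := ∑ j ∈ range (q.natDegree + 1), q.coeff j * (∏ m ∈ range j, (u - (m : ℝ) / n)) *
        (∏ m ∈ range (q.natDegree - j), ((1 - u) - (m : ℝ) / n)) with hS
    have happrox := polya_sum_approx q n u hu0 hu1 hn0 hdn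
    have hbound : A * ((d : ℝ) * ((d : ℝ) / n)) < μ := by
      have h1 : A * ((d : ℝ) * d) < μ * N := by
        have := (div_lt_iff₀ hμ).mp hN
        linarith
      have h2 : (N : ℝ) ≤ n := by exact_mod_cast (Nat.le_add_right N d)
      have h3 : μ * N ≤ μ * n := by gcongr
      rw [show A * ((d : ℝ) * ((d : ℝ) / n)) = A * ((d : ℝ) * d) / n by ring, div_lt_iff₀ hn0']
      linarith
    have hSpos : 0 < S := by
      have h1 := hμle u hu0 hu1
      have h2 := (abs_sub_le_iff.mp happrox).2
      rw [← hA, ← hS] at h2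
      linarith
    -- `P = Σ aⱼ k^{(j)} b^{(d-j)} = n^d · S`
    have hP : ∑ j ∈ range (q.natDegree + 1), q.coeff j * (k.descFactorial j : ℝ) *
        ((N + q.natDegree - k).descFactorial (q.natDegree - j) : ℝ) = (n : ℝ) ^ d * S := by
      rw [hS, mul_sum]
      refine sum_congr rfl fun j hj => ?_
      have hjd : j ≤ q.natDegree := Nat.lt_succ_iff.mp (mem_range.mp hj)
      rw [polya_descFactorial_eq_pow_mul_prod n k j hn0,
        polya_descFactorial_eq_pow_mul_prod n (N + q.natDegree - k) (q.natDegree - j) hn0]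
      rw [show ((N + q.natDegree - k : ℕ) : ℝ) / n = 1 - u from hbu]
      rw [show (n : ℝ) ^ d = (n : ℝ) ^ j * (n : ℝ) ^ (q.natDegree - j) by
        rw [← pow_add, hd, Nat.add_sub_cancel' hjd]]
      ring
    have hfac : 0 < (k.factorial : ℝ) * ((N + q.natDegree - k).factorial : ℝ) := by positivity
    have hprod : 0 < (((1 : ℝ[X]) + X) ^ N * q).coeff k *
        ((k.factorial : ℝ) * ((N + q.natDegree - k).factorial : ℝ)) := by
      rw [polya_coeff_mul_factorial q N k hk, hP]
      positivity
    exact ((mul_pos_iff_of_pos_right hfac).mp hprod).le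
  · -- degrees `k > N + d`: the coefficient vanishes
    push Not at hk
    have hdeg : (((1 : ℝ[X]) + X) ^ N * q).natDegree < k := by
      refine lt_of_le_of_lt ?_ hk
      refine natDegree_mul_le.trans ?_
      have h1 : (((1 : ℝ[X]) + X) ^ N).natDegree ≤ N := by
        refine natDegree_pow_le.trans ?_
        have h2 : ((1 : ℝ[X]) + X).natDegree ≤ 1 :=
          (natDegree_add_le _ _).trans (by simp)
        calc N * ((1 : ℝ[X]) + X).natDegree ≤ N * 1 := Nat.mul_le_mul_left N h2
          _ = N := Nat.mul_one N
      omega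
    rw [coeff_eq_zero_of_natDegree_lt hdeg]

end Summit.HodgeConjecture.HodgeConjecture.Theorems.WeilTwelvefoldsSqrtMinus7.PolyaGluedBoxProducts

end
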